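import Summits.Ventures.DiscreteObjects.UnitDistance.PlaneLowerBoundFive
import Summits.Ventures.DiscreteObjects.UnitDistance.FieldPlanes
import HarnessLib

/-!
# Every 4-colouring of `K²` (`√3, √5 ∈ K`) has a monochromatic equilateral `√3`-triple — de Grey's assembly inside `ℚ(√3,√5)`
(cell `pub-namedobj`, target (U), seat udg g23)

Framing (verbatim for the cell): lottery ticket; floor = certified bounds/negative ranges.

de Grey (arXiv:1804.02385, §3) assembles `5 ≤ χ(ℝ²)` from two finite facts: (Part 2, his 61-vertex graph `K ⊂ ℚ(√3,√5)·`, kernel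
theorem `K61_linking_diagonal` of `PlaneK61.lean`) in a 4-colouring with no monochromatic `√3`-triple the two ends of a linking diagonal
(distance `4`) have the same colour, and (Part 1, the 1345-vertex `M`) a gadget forbidding a monochromatic `√3`-triple.  His graph `L`
closes the argument by rotating `K` about a linking vertex by `2·arcsin(1/8)`, i.e. with the point `(31 + 3√7·i)/8` — this needs `√7`,
which is NOT available inside `ℚ₁₁` (`7` is a non-residue mod `11`), so `L` as printed is useless for the cell's question
`χ(ℚ(√3,√5)²) = χ(ℚ₁₁²) ∈ {4,5}` (THEORY-U20/U21 of the cell).  THIS FILE replaces the last link by a closed chain of FOUR diagonals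
inside `ℚ(√15) ⊂ ℚ(√3,√5)`: `0, 4, 8, 9/2 − (√15/2)i, 1` are consecutively at distance `4` (because `1/4 = 2 − θ₄ − θ̄₄`,
`θ₄ = (7 + i√15)/8`) and `|1 − 0| = 1`.  Consequence, in FIELD form (vocabulary of `FieldPlanes.lean`): for every real field `K ∋ √3, √5` and
every proper 4-colouring `C` of the unit-distance graph on `K² = fieldPoints K`, some equilateral triangle of side `√3` with vertices in
`K²` is monochromatic (`exists_monochromatic_sqrt3_triple`); equivalently (`not_colorable_four_plane_of_no_monochromatic_otriple`) a
de Grey-type TRIPLE GADGET over an admissible field `K' ⊂ ℚ₁₁`, `K' ⊇ ℚ(√3,√5)` — a finite unit-distance graph over `K'` in which one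
positively oriented `√3`-triple is never monochromatic in 4 colours, transported by the `K'`-rational direct isometries — gives
`χ(K'²) = 5` and hence `χ(ℚ₁₁²) = 5`.  This is strictly stronger than the pair form `exists_monochromatic_sqrt3_pair`
(`Sqrt3PairReduction.lean`, udg g21: a monochromatic `√3`-PAIR — two vertices of the monochromatic triangle), whose contrapositive asks
for Haugland's stronger pair gadget; the cell's
calibration (udg g23, FAMILIES-U23): Heule's `V⊕V⊕V` over the Moser field is a triple gadget but not a pair gadget.
Proof = de Grey's Part 2 (kernel theorem `K61_linking_diagonal`, reused verbatim) moved around by `K`-rational direct isometries of `ℂ`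
(`simil`, `PlaneLowerBoundFive.lean`), plus the four-diagonal chain.  The argument is de Grey's; the `ℚ(√3,√5)`-internal chain and the
field form are the cell's.  Nothing here is cited as a fact.
-/

noncomputable section

namespace Summit.Ventures.DiscreteObjects.UnitDistance

open Complex SimpleGraph IntermediateField KTri

namespace Sqrt3Triple

variable {K : IntermediateField ℚ ℝ}

/-- The `K`-points of `ℂ` (`K(i) = K² ⊂ ℂ`): both real coordinates lie in `K`. -/
def pointsK (K : IntermediateField ℚ ℝ) : Set ℂ := {z | z.re ∈ K ∧ z.im ∈ K}

/-- `K²` is closed under addition. -/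
theorem memK_add {z w : ℂ} (hz : z ∈ pointsK K) (hw : w ∈ pointsK K) : (z + w) ∈ pointsK K :=
  ⟨by rw [add_re]; exact add_mem hz.1 hw.1, by rw [add_im]; exact add_mem hz.2 hw.2⟩

/-- `K²` is closed under subtraction. -/
theorem memK_sub {z w : ℂ} (hz : z ∈ pointsK K) (hw : w ∈ pointsK K) : (z - w) ∈ pointsK K :=
  ⟨by rw [sub_re]; exact sub_mem hz.1 hw.1, by rw [sub_im]; exact sub_mem hz.2 hw.2⟩

/-- `K(i)` is closed under complex multiplication. -/
theorem memK_mul {z w : ℂ} (hz : z ∈ pointsK K) (hw : w ∈ pointsK K) : (z * w) ∈ pointsK K :=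
  ⟨by rw [mul_re]; exact sub_mem (mul_mem hz.1 hw.1) (mul_mem hz.2 hw.2),
   by rw [mul_im]; exact add_mem (mul_mem hz.1 hw.2) (mul_mem hz.2 hw.1)⟩

/-- Division by `4` stays in `K(i)`. -/
theorem memK_div_four {z : ℂ} (hz : z ∈ pointsK K) : (z / 4) ∈ pointsK K :=
  ⟨by rw [Complex.div_ofNat_re]; exact div_mem hz.1 (by exact_mod_cast IntermediateField.natCast_mem K 4),
   by rw [Complex.div_ofNat_im]; exact div_mem hz.2 (by exact_mod_cast IntermediateField.natCast_mem K 4)⟩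

/-- Natural numbers are `K`-points. -/
theorem memK_natCast (K : IntermediateField ℚ ℝ) (n : ℕ) : (n : ℂ) ∈ pointsK K :=
  ⟨by rw [natCast_re]; exact IntermediateField.natCast_mem K n, by rw [natCast_im]; exact zero_mem K⟩

/-- A point given by its two coordinates. -/
theorem memK_mk {a b : ℝ} (ha : a ∈ K) (hb : b ∈ K) : ⟨a, b⟩ ∈ pointsK K := ⟨ha, hb⟩

/-- `√15 = √3·√5 ∈ K`. -/
theorem sqrt15_mem (h3 : Real.sqrt 3 ∈ K) (h5 : Real.sqrt 5 ∈ K) : Real.sqrt 15 ∈ K := by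
  rw [← sqrt3_mul_sqrt5]; exact mul_mem h3 h5

/-- The vertices `(a + b√5 + i(c√3 + d√15))/16` of de Grey's `K` are `K`-points. -/
theorem memK_pt5 (h3 : Real.sqrt 3 ∈ K) (h5 : Real.sqrt 5 ∈ K) (p : ℤ × ℤ × ℤ × ℤ) : (pt5 p) ∈ pointsK K := by
  refine ⟨?_, ?_⟩
  · show ((p.1 : ℝ) + p.2.1 * Real.sqrt 5) / 16 ∈ K
    exact div_mem (add_mem (intCast_mem K _) (mul_mem (intCast_mem K _) h5)) (by exact_mod_cast IntermediateField.natCast_mem K 16)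
  · show ((p.2.2.1 : ℝ) * Real.sqrt 3 + p.2.2.2 * Real.sqrt 15) / 16 ∈ K
    exact div_mem (add_mem (mul_mem (intCast_mem K _) h3) (mul_mem (intCast_mem K _) (sqrt15_mem h3 h5)))
      (by exact_mod_cast IntermediateField.natCast_mem K 16)

/-- The standard isometry `ℂ ≃ ℝ²`. -/
def eC : ℂ ≃ₗᵢ[ℝ] EuclideanSpace ℝ (Fin 2) := Complex.orthonormalBasisOneI.repr

/-- It is an isometry: `dist (eC z) (eC w) = ‖z − w‖`. -/
theorem dist_eC (z w : ℂ) : dist (eC z) (eC w) = ‖z - w‖ := by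
  rw [dist_eq_norm, ← map_sub, LinearIsometryEquiv.norm_map]

/-- `K`-points of `ℂ` go to `fieldPoints K`. -/
theorem eC_mem {z : ℂ} (hz : z ∈ pointsK K) : eC z ∈ fieldPoints K := by
  intro i
  fin_cases i
  · simpa [eC] using hz.1
  · simpa [eC] using hz.2

open Classical in
/-- The colour (as a natural number) of a `K`-point of `ℂ` under `C`; junk value `0` off `K²`. -/
def col (C : (planeUnitDistanceGraph.induce (fieldPoints K)).Coloring (Fin 4)) (z : ℂ) : ℕ :=
  if h : z ∈ pointsK K then (C ⟨eC z, eC_mem h⟩).val else 0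

/-- Unfolding `col` at a `K`-point. -/
theorem col_eq (C : (planeUnitDistanceGraph.induce (fieldPoints K)).Coloring (Fin 4)) {z : ℂ} (hz : z ∈ pointsK K) :
    col C z = (C ⟨eC z, eC_mem hz⟩).val := by
  rw [col, dif_pos hz]

/-- Colours are `< 4`. -/
theorem col_lt (C : (planeUnitDistanceGraph.induce (fieldPoints K)).Coloring (Fin 4)) {z : ℂ} (hz : z ∈ pointsK K) : col C z < 4 := by
  rw [col_eq C hz]; exact (C _).isLt

/-- `K`-points at distance `1` get different colours. -/
theorem col_ne (C : (planeUnitDistanceGraph.induce (fieldPoints K)).Coloring (Fin 4)) {z w : ℂ} (hz : z ∈ pointsK K) (hw : w ∈ pointsK K)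
    (h : ‖z - w‖ = 1) : col C z ≠ col C w := by
  rw [col_eq C hz, col_eq C hw]
  intro heq
  have hadj : (planeUnitDistanceGraph.induce (fieldPoints K)).Adj ⟨eC z, eC_mem hz⟩ ⟨eC w, eC_mem hw⟩ := by
    show dist (eC z) (eC w) = 1
    rw [dist_eC]; exact h
  exact C.valid hadj (Fin.ext heq)

/-- PART 2 INSIDE `K²`: if no positively oriented `√3`-triple of `K`-points is monochromatic under `C`, then any two `K`-points at
distance `4` have the same colour (de Grey's `K`, kernel theorem `K61_linking_diagonal`, moved by a `K`-rational direct isometry). -/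
theorem col_eq_of_dist_four (C : (planeUnitDistanceGraph.induce (fieldPoints K)).Coloring (Fin 4)) (h3 : Real.sqrt 3 ∈ K) (h5 : Real.sqrt 5 ∈ K)
    (hno : ∀ x y z : ℂ, x ∈ pointsK K → y ∈ pointsK K → z ∈ pointsK K → IsOTriple x y z → ¬ (col C x = col C y ∧ col C y = col C z))
    {P Q : ℂ} (hP : P ∈ pointsK K) (hQ : Q ∈ pointsK K) (hPQ : ‖Q - P‖ = 4) : col C P = col C Q := by
  have hA : pt5 (K61co 0) = 2 := by
    rw [K61co_special.1]; apply Complex.ext <;> norm_num [pt5]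
  have hB : pt5 (K61co 1) = -2 := by
    rw [K61co_special.2.1]; apply Complex.ext <;> norm_num [pt5]
  have h2 : 2 ∈ pointsK K := by simpa using memK_natCast K 2
  -- the `K`-rational direct isometry with `2 ↦ P`, `−2 ↦ Q`
  let u : ℂ := (P - Q) / 4
  have hu : ‖u‖ = 1 := by
    show ‖(P - Q) / 4‖ = 1
    rw [norm_div, norm_sub_rev, hPQ]; norm_num
  have humem : u ∈ pointsK K := memK_div_four (memK_sub hP hQ)
  let ψ : ℂ → ℂ := simil P u 2
  have hψmem : ∀ w, w ∈ pointsK K → (ψ w) ∈ pointsK K := fun w hw => memK_add hP (memK_mul humem (memK_sub hw h2))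
  have hψA : ψ 2 = P := by simp [ψ, simil]
  have hψB : ψ (-2) = Q := by
    show P + (P - Q) / 4 * (-2 - 2) = Q; ring
  let colK : ℕ → ℕ := fun v => col C (ψ (pt5 (K61co v)))
  have hPr : KTri.Proper K61nb K61tp 61 colK := by
    intro v hv
    have hvmem : (ψ (pt5 (K61co v))) ∈ pointsK K := hψmem _ (memK_pt5 h3 h5 _)
    refine ⟨col_lt C hvmem, ?_, ?_⟩
    · intro w _ hbit heq
      have hd : ‖pt5 (K61co v) - pt5 (K61co w)‖ = 1 := norm_sub_pt5 (K61_unit_of_testBit v w hv hbit)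
      have hwmem : (ψ (pt5 (K61co w))) ∈ pointsK K := hψmem _ (memK_pt5 h3 h5 _)
      have h1 : ‖ψ (pt5 (K61co v)) - ψ (pt5 (K61co w))‖ = 1 := by rw [norm_simil_sub hu, hd]
      exact col_ne C hvmem hwmem h1 heq.symm
    · intro p hp ⟨e1, e2⟩
      have hot : IsOTriple (ψ (pt5 (K61co v))) (ψ (pt5 (K61co p.1))) (ψ (pt5 (K61co p.2))) :=
        simil_otriple hu (otriple_pt5 (K61tp_oriented v hv p hp))
      exact hno _ _ _ hvmem (hψmem _ (memK_pt5 h3 h5 _)) (hψmem _ (memK_pt5 h3 h5 _)) hot ⟨e1.symm, e1.trans e2.symm⟩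
  have h01 : col C (ψ (pt5 (K61co 0))) = col C (ψ (pt5 (K61co 1))) := K61_linking_diagonal hPr
  rwa [hA, hB, hψA, hψB] at h01

/-- THE FOUR-DIAGONAL CHAIN inside `ℚ(√15)`: `0, 4, 8, 9/2 − (√15/2)i, 1` are consecutively at distance `4` and `|0 − 1| = 1`; hence the
hypothesis "no monochromatic positively oriented `√3`-triple of `K`-points" is contradictory for every 4-colouring `C` of `K²`. -/
theorem false_of_no_monochromatic_otriple (C : (planeUnitDistanceGraph.induce (fieldPoints K)).Coloring (Fin 4)) (h3 : Real.sqrt 3 ∈ K) (h5 : Real.sqrt 5 ∈ K)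
    (hno : ∀ x y z : ℂ, x ∈ pointsK K → y ∈ pointsK K → z ∈ pointsK K → IsOTriple x y z → ¬ (col C x = col C y ∧ col C y = col C z)) :
    False := by
  let R : ℂ := ⟨9 / 2, -(Real.sqrt 15 / 2)⟩
  have m0 : 0 ∈ pointsK K := by simpa using memK_natCast K 0
  have m1 : 1 ∈ pointsK K := by simpa using memK_natCast K 1
  have m4 : 4 ∈ pointsK K := by simpa using memK_natCast K 4
  have m8 : 8 ∈ pointsK K := by simpa using memK_natCast K 8
  have mR : R ∈ pointsK K :=
    memK_mk (div_mem (by exact_mod_cast IntermediateField.natCast_mem K 9) (by exact_mod_cast IntermediateField.natCast_mem K 2))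
      (neg_mem (div_mem (sqrt15_mem h3 h5) (by exact_mod_cast IntermediateField.natCast_mem K 2)))
  have h04 : ‖(4 : ℂ) - 0‖ = 4 := by simp
  have h48 : ‖(8 : ℂ) - 4‖ = 4 := by norm_num
  have h8R : ‖R - 8‖ = 4 := by
    rw [show R - 8 = ⟨9 / 2 - 8, -(Real.sqrt 15 / 2)⟩ from by apply Complex.ext <;> simp [R], Complex.norm_def,
      Complex.normSq_mk]
    rw [show ((9 : ℝ) / 2 - 8) * (9 / 2 - 8) + -(Real.sqrt 15 / 2) * -(Real.sqrt 15 / 2) = 4 * 4 by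
      linear_combination (1 / 4 : ℝ) * ms_sqrt15]
    exact Real.sqrt_mul_self (by norm_num)
  have hR1 : ‖(1 : ℂ) - R‖ = 4 := by
    rw [show (1 : ℂ) - R = ⟨1 - 9 / 2, Real.sqrt 15 / 2⟩ from by apply Complex.ext <;> simp [R], Complex.norm_def,
      Complex.normSq_mk]
    rw [show ((1 : ℝ) - 9 / 2) * (1 - 9 / 2) + Real.sqrt 15 / 2 * (Real.sqrt 15 / 2) = 4 * 4 by
      linear_combination (1 / 4 : ℝ) * ms_sqrt15]
    exact Real.sqrt_mul_self (by norm_num)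
  have h01 : ‖(0 : ℂ) - 1‖ = 1 := by simp
  have e1 : col C 0 = col C 4 := col_eq_of_dist_four C h3 h5 hno m0 m4 h04
  have e2 : col C 4 = col C 8 := col_eq_of_dist_four C h3 h5 hno m4 m8 h48
  have e3 : col C 8 = col C R := col_eq_of_dist_four C h3 h5 hno m8 mR h8R
  have e4 : col C R = col C 1 := col_eq_of_dist_four C h3 h5 hno mR m1 hR1
  exact col_ne C m0 m1 h01 (e1.trans (e2.trans (e3.trans e4)))

/-- `‖ω‖ = 1`. -/
theorem norm_omegaC : ‖omegaC‖ = 1 := by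
  apply norm_eq_one_of_normSq
  rw [omegaC, Complex.normSq_mk]
  linear_combination (1 / 4 : ℝ) * (Real.mul_self_sqrt (show (0 : ℝ) ≤ 3 by norm_num))

/-- `‖ω − 1‖ = 1`. -/
theorem norm_omegaC_sub_one : ‖omegaC - 1‖ = 1 := by
  apply norm_eq_one_of_normSq
  rw [show omegaC - 1 = ⟨1 / 2 - 1, Real.sqrt 3 / 2⟩ from by apply Complex.ext <;> simp [omegaC], Complex.normSq_mk]
  linear_combination (1 / 4 : ℝ) * (Real.mul_self_sqrt (show (0 : ℝ) ≤ 3 by norm_num))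

/-- The three side lengths of a positively oriented `√3`-triple. -/
theorem dists_of_isOTriple {x y z : ℂ} (h : IsOTriple x y z) :
    ‖x - y‖ = Real.sqrt 3 ∧ ‖x - z‖ = Real.sqrt 3 ∧ ‖y - z‖ = Real.sqrt 3 := by
  obtain ⟨h1, h2⟩ := h
  have hyx : ‖y - x‖ = Real.sqrt 3 := by
    rw [← Real.sqrt_sq (norm_nonneg (y - x)), h1]
  refine ⟨by rw [norm_sub_rev, hyx], ?_, ?_⟩
  · rw [norm_sub_rev, h2, norm_mul, norm_omegaC, one_mul, hyx]
  · rw [norm_sub_rev, show z - y = (omegaC - 1) * (y - x) by rw [sub_mul, ← h2]; ring, norm_mul, norm_omegaC_sub_one,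
      one_mul, hyx]

end Sqrt3Triple

open Sqrt3Triple

/-- DE GREY'S ASSEMBLY, FIELD FORM: for a real field `K ∋ √3, √5`, every proper `4`-colouring of the unit-distance graph of `K²` makes
some equilateral triangle of side `√3` with vertices in `K²` MONOCHROMATIC. -/
theorem exists_monochromatic_sqrt3_triple (K : IntermediateField ℚ ℝ) (h3 : Real.sqrt 3 ∈ K) (h5 : Real.sqrt 5 ∈ K)
    (C : (planeUnitDistanceGraph.induce (fieldPoints K)).Coloring (Fin 4)) :
    ∃ p q r : fieldPoints K, dist (p : EuclideanSpace ℝ (Fin 2)) q = Real.sqrt 3 ∧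
      dist (p : EuclideanSpace ℝ (Fin 2)) r = Real.sqrt 3 ∧ dist (q : EuclideanSpace ℝ (Fin 2)) r = Real.sqrt 3 ∧
      C p = C q ∧ C q = C r := by
  by_contra hne
  apply false_of_no_monochromatic_otriple C h3 h5
  intro x y z hx hy hz hot hcol
  obtain ⟨exy, eyz⟩ := hcol
  obtain ⟨dxy, dxz, dyz⟩ := dists_of_isOTriple hot
  apply hne
  refine ⟨⟨eC x, eC_mem hx⟩, ⟨eC y, eC_mem hy⟩, ⟨eC z, eC_mem hz⟩, ?_, ?_, ?_, ?_, ?_⟩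
  · show dist (eC x) (eC y) = Real.sqrt 3
    rw [dist_eC, dxy]
  · show dist (eC x) (eC z) = Real.sqrt 3
    rw [dist_eC, dxz]
  · show dist (eC y) (eC z) = Real.sqrt 3
    rw [dist_eC, dyz]
  · rw [col_eq C hx, col_eq C hy] at exy
    exact Fin.ext exy
  · rw [col_eq C hy, col_eq C hz] at eyz
    exact Fin.ext eyz

/-- TRIPLE-GADGET FORM (the contrapositive, as used by the cell): if some argument shows that NO positively oriented equilateral
`√3`-triple of `K`-points of `ℂ` is monochromatic in any proper `4`-colouring of `K²` — e.g. a finite unit-distance graph over `K` whose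
designated `√3`-triple is never monochromatic in 4 colours, moved around by the `K`-rational direct isometries — then `K²` is not
`4`-colourable.  For an admissible `K ⊂ ℚ₁₁` with `√3, √5 ∈ K` this would give `χ(K²) = 5` and `χ(ℚ₁₁²) = 5`. -/
theorem not_colorable_four_plane_of_no_monochromatic_otriple (K : IntermediateField ℚ ℝ) (h3 : Real.sqrt 3 ∈ K)
    (h5 : Real.sqrt 5 ∈ K)
    (h : ∀ C : (planeUnitDistanceGraph.induce (fieldPoints K)).Coloring (Fin 4),
      ∀ x y z : ℂ, x ∈ pointsK K → y ∈ pointsK K → z ∈ pointsK K → IsOTriple x y z → ¬ (col C x = col C y ∧ col C y = col C z)) :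
    ¬ (planeUnitDistanceGraph.induce (fieldPoints K)).Colorable 4 := by
  rintro ⟨C⟩
  exact false_of_no_monochromatic_otriple C h3 h5 (h C)

end Summit.Ventures.DiscreteObjects.UnitDistance
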